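import Summits.QuantumFields.BalabanUV.Beta.D1BFx.MomentTransferPeriodic

/-!
# `BalabanUV.Beta.D1BFx.MomentTransferPeriodicMaster` — road «BF-x» for binder row D1, leaf K-R5 (part 1, §3):
# THE NINE-TERM MASTER IDENTITY for the decimated second moment of a two-sided dressed sum with a BLOCK-PERIODIC
# fine kernel, every cross term an explicit finite sum over base points, and its VANISHING FORM
# `σ · σ' · Σ_{base points b} Σ_t t_κ t_λ P (b+t) b`

HONEST FRAMING (cell contract, verbatim): «discharging `BetaPertH` makes Bałaban's UV stability UNCONDITIONAL — a real
constructive-QFT result; it is NOT the continuum limit and NOT the Clay problem.»  [folklore] bookkeeping of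
unconditionally convergent lattice sums over `ℝ`, composed BY NAME from `MomentTransferPeriodic` §2 (the collapse
lemmas) and `DecimatedMomentSummable.second_weight_expand` (the nine monomials); nothing of the manuscripts under audit
is asserted or cited; no `Prop` fact minted; nothing of D1 / BetaPertH discharged.  Value = kernel bookkeeping leaf of
road BF-x (skeleton `HOME/beta/skeletons/D1-b2b-balaban-beta-d1-p2.md` v1.4 node R5; typer brief
`HOME/b2b-balaban-beta-d1-p2/TYPER-SPEC-D1BFx.md` §2 K-R5), NOT summit progress; NOT continuum, NOT Clay.
HONEST DEPENDENCY (verbatim): continuum YM on T⁴ ⇐ BetaPertH ∧ nine spine estimates (0/9 proved); BetaPertH ⇐ (D1) ∧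
(D4) ∧ CAP+tail; G-an2-4 gates asym, D1 and NE2/3/4.

CONTENT (all [folklore]): `MonoSummableP`, `summable_termP_second`, **`hasSum_termP_second`** (nine terms),
**`hasSum_termP_second_of_vanishing`** (main term only), `sum_const_mul_eq` (consistency of the value with the
translation-invariant `σ · m₂ · n₀`).  See the header of `MomentTransferPeriodic` for the computation.
-/

namespace Summit.QuantumFields.BalabanUV.Beta.D1BFx.MomentTransferPeriodicMaster

open Finset Filter Topology
open Literature.MathematicalPhysics.QuantumFieldTheory.Balaban1983to89
open Literature.MathematicalPhysics.QuantumFieldTheory.Balaban1983to89.Beta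
open DecimatedMoment (cosetInd)
open DecimatedMomentSummable (mono IsMoment₂ second_weight_expand ConstReproSum LinReproSum)
open DressedMomentNormalisation (resSite)
open MomentTransferPeriodic

variable {d N : ℕ}

/-! ## §3 The nine-term master identity for a block-periodic kernel, and its vanishing form -/

section Master

variable (w : (Fin d → ℤ) → ℝ) (P : Ker₂ d) (w' : (Fin d → ℤ) → ℝ)

/-- Summability of the triple family for every product weight of letters `1, y_μ, y_μ y_ν` (the analogue of
`DecimatedMomentSummable.MonoSummable`; discharged over `ℝ` from absolutely summable second moments and a summable
majorant of the base-point kernels in `MomentTransferPeriodicSum`). [folklore] -/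
def MonoSummableP (N : ℕ) (w : (Fin d → ℤ) → ℝ) (P : Ker₂ d) (w' : (Fin d → ℤ) → ℝ) : Prop :=
  ∀ p q r, IsMoment₂ p → IsMoment₂ q → IsMoment₂ r → Summable (termP N w P w' (mono p q r))

/-- The second-moment triple family is summable under `MonoSummableP` (signed sum of nine monomial families).
[folklore] -/
theorem summable_termP_second (κ l : Fin d) (hS : MonoSummableP N w P w') :
    Summable (termP N w P w' (fun u t x => (t + x - u) κ * (t + x - u) l)) := by
  rw [second_weight_expand, termP_add, termP_sub, termP_sub, termP_add, termP_sub, termP_sub, termP_add, termP_add]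
  exact ((((((((hS _ _ _ .one (.coord2 κ l) .one).add (hS _ _ _ .one (.coord κ) (.coord l))).add
    (hS _ _ _ .one (.coord l) (.coord κ))).sub (hS _ _ _ (.coord l) (.coord κ) .one)).sub
    (hS _ _ _ (.coord κ) (.coord l) .one)).add (hS _ _ _ .one .one (.coord2 κ l))).sub
    (hS _ _ _ (.coord l) .one (.coord κ))).sub (hS _ _ _ (.coord κ) .one (.coord l))).add
    (hS _ _ _ (.coord2 κ l) .one .one)

/-- **THE NINE-TERM MASTER IDENTITY, BLOCK-PERIODIC FORM** (`0 < N`; NO vanishing hypothesis on `P`).  Data: the LEFT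
pattern `w` reproduces constants (`σ`) and affine functions (`C`) through `N•ℤ^d` and has coset second moments `p₂ a`;
the RIGHT pattern `w'` likewise (`σ'`, `C'`, coset second moments `n₂ a`); the block-periodic kernel `P` has, at every
base point `b`, column sum `m₀ b = Σ_t P (b+t) b`, first moments `m₁ μ b = Σ_t t_μ P (b+t) b`, second moment
`m₂ b = Σ_t t_κ t_λ P (b+t) b`, and row sum `R₀ b = Σ_{s'} P b s'`.  Then the `N•ℤ^d`-windowed second moment of the
two-sided dressed sum — the triple family with weight `(t + x − u)_κ (t + x − u)_λ` — HAS THE SUM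
`σ·Σ_b m₂ b·σ' + σ·Σ_b m₁κ b·C'λ + σ·Σ_b m₁λ b·C'κ − Cλ·Σ_b m₁κ b·σ' − Cκ·Σ_b m₁λ b·σ' + σ·Σ_b m₀ b·n₂ b − Cλ·Σ_b m₀ b·C'κ
 − Cκ·Σ_b m₀ b·C'λ + σ'·Σ_b R₀ b·p₂ b`, every `Σ_b` a FINITE sum over the `N^d` base points `resSite b` — the
translation-invariant nine-term identity `DecimatedMomentSummable.hasSum_term_second` with every kernel moment replaced
by its sum over base points and every pattern moment by its coset version (the six cross terms of
`MomentFactorisation.M2_dressed_ward` + the two `M0`-terms, EXPLICIT). [folklore] -/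
theorem hasSum_termP_second (hN : 0 < N) (hP : IsBlockPeriodic N P) {σ σ' : ℝ} {C C' : Fin d → ℝ}
    (hL0 : ConstReproSum N w σ) (hL1 : LinReproSum N w C) (hR0 : ConstReproSum N w' σ') (hR1 : LinReproSum N w' C')
    (κ l : Fin d) {m₀ m₂ R₀ n₂ p₂ : (Fin d → ℤ) → ℝ} {m₁ : Fin d → (Fin d → ℤ) → ℝ}
    (hm0 : ∀ b, HasSum (baseKer P b) (m₀ b)) (hm1 : ∀ b μ, HasSum (fun t => t μ • baseKer P b t) (m₁ μ b))
    (hm2 : ∀ b, HasSum (fun t => (t κ * t l) • baseKer P b t) (m₂ b)) (hrow : ∀ b, HasSum (P b) (R₀ b))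
    (hn2 : ∀ a, HasSum (fun x => (cosetInd N (a - x) * (x κ * x l)) • w' x) (n₂ a))
    (hp2 : ∀ a, HasSum (fun u => (cosetInd N (a - u) * (u κ * u l)) • w u) (p₂ a))
    (hS : MonoSummableP N w P w') :
    HasSum (termP N w P w' (fun u t x => (t + x - u) κ * (t + x - u) l))
      (σ * (∑ b : Fin d → Fin N, m₂ (resSite b) * σ')
        + σ * (∑ b : Fin d → Fin N, m₁ κ (resSite b) * C' l)
        + σ * (∑ b : Fin d → Fin N, m₁ l (resSite b) * C' κ)
        - C l * (∑ b : Fin d → Fin N, m₁ κ (resSite b) * σ')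
        - C κ * (∑ b : Fin d → Fin N, m₁ l (resSite b) * σ')
        + σ * (∑ b : Fin d → Fin N, m₀ (resSite b) * n₂ (resSite b))
        - C l * (∑ b : Fin d → Fin N, m₀ (resSite b) * C' κ)
        - C κ * (∑ b : Fin d → Fin N, m₀ (resSite b) * C' l)
        + σ' * (∑ b : Fin d → Fin N, R₀ (resSite b) * p₂ (resSite b))) := by
  have hW := DecimatedMomentSummable.hasSum_window_one (cosetInd N) w hL0
  have hW' := DecimatedMomentSummable.hasSum_window_one (cosetInd N) w' hR0
  have hm0' : ∀ b, HasSum (fun t => (fun _ => (1 : ℤ)) t • baseKer P b t) (m₀ b) :=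
    fun b => DecimatedMomentSummable.hasSum_one_smul (hm0 b)
  rw [second_weight_expand, termP_add, termP_sub, termP_sub, termP_add, termP_sub, termP_sub, termP_add, termP_add]
  simp only [Pi.add_def, Pi.sub_def]
  exact ((((((((hasSum_termP_left w P w' hN hP _ hW _ _ hm2 hW' (hS _ _ _ .one (.coord2 κ l) .one)).add
    (hasSum_termP_left w P w' hN hP _ hW _ _ (fun b => hm1 b κ) (fun a => hR1 a l)
      (hS _ _ _ .one (.coord κ) (.coord l)))).add
    (hasSum_termP_left w P w' hN hP _ hW _ _ (fun b => hm1 b l) (fun a => hR1 a κ)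
      (hS _ _ _ .one (.coord l) (.coord κ)))).sub
    (hasSum_termP_left w P w' hN hP _ (fun a => hL1 a l) _ _ (fun b => hm1 b κ) hW'
      (hS _ _ _ (.coord l) (.coord κ) .one))).sub
    (hasSum_termP_left w P w' hN hP _ (fun a => hL1 a κ) _ _ (fun b => hm1 b l) hW'
      (hS _ _ _ (.coord κ) (.coord l) .one))).add
    (hasSum_termP_left w P w' hN hP _ hW _ _ hm0' hn2 (hS _ _ _ .one .one (.coord2 κ l)))).sub
    (hasSum_termP_left w P w' hN hP _ (fun a => hL1 a l) _ _ hm0' (fun a => hR1 a κ)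
      (hS _ _ _ (.coord l) .one (.coord κ)))).sub
    (hasSum_termP_left w P w' hN hP _ (fun a => hL1 a κ) _ _ hm0' (fun a => hR1 a l)
      (hS _ _ _ (.coord κ) .one (.coord l)))).add
    (hasSum_termP_right w P w' hN hP hR0 (fun u => u κ * u l) hrow hp2 (hS _ _ _ (.coord2 κ l) .one .one))

/-- **THE IDENTITY UNDER THE VANISHING HYPOTHESES** — columns AND rows of `P` sum to zero at every point
(`Σ_t P (b+t) b = 0 = Σ_{s'} P b s'`: the kernel kills constants on both sides) and the base-point-AVERAGED first
moments vanish (`Σ_b m₁ μ b = 0`; NOT assumed pointwise — for a symmetric block-periodic kernel this is automatic, part 2),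
both patterns reproducing constants and affine functions: of the nine monomial families five have the sum `0`
fibrewise and three vanish after the class sum, so the windowed second moment of the dressed sum is the MAIN TERM
`σ · σ' · Σ_{b : classes} m₂ b` — masses × the SUM OVER BASE POINTS of the fine second moment.  No coset second moment of
either pattern is needed. [folklore] -/
theorem hasSum_termP_second_of_vanishing (hN : 0 < N) (hP : IsBlockPeriodic N P) {σ σ' : ℝ} {C C' : Fin d → ℝ}
    (hL0 : ConstReproSum N w σ) (hL1 : LinReproSum N w C) (hR0 : ConstReproSum N w' σ') (hR1 : LinReproSum N w' C')
    (κ l : Fin d) {m₂ : (Fin d → ℤ) → ℝ} {m₁ : Fin d → (Fin d → ℤ) → ℝ}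
    (hcol : ∀ b, HasSum (baseKer P b) 0) (hrow : ∀ b, HasSum (P b) 0)
    (hm1 : ∀ b μ, HasSum (fun t => t μ • baseKer P b t) (m₁ μ b))
    (hT1 : ∀ μ, ∑ b : Fin d → Fin N, m₁ μ (resSite b) = 0)
    (hm2 : ∀ b, HasSum (fun t => (t κ * t l) • baseKer P b t) (m₂ b)) (hS : MonoSummableP N w P w') :
    HasSum (termP N w P w' (fun u t x => (t + x - u) κ * (t + x - u) l))
      (σ * σ' * ∑ b : Fin d → Fin N, m₂ (resSite b)) := by
  have hW := DecimatedMomentSummable.hasSum_window_one (cosetInd N) w hL0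
  have hW' := DecimatedMomentSummable.hasSum_window_one (cosetInd N) w' hR0
  have h0' : ∀ b, HasSum (fun t => (fun _ => (1 : ℤ)) t • baseKer P b t) 0 :=
    fun b => DecimatedMomentSummable.hasSum_one_smul (hcol b)
  -- the three first-moment families: class sums vanish by (T1-avg)
  have hfirst : ∀ {ρ ν : ℝ} (μ : Fin d) (pw r : (Fin d → ℤ) → ℤ),
      (∀ a, HasSum (fun u => (cosetInd N (a - u) * pw u) • w u) ρ) →
      (∀ a, HasSum (fun x => (cosetInd N (a - x) * r x) • w' x) ν) →
      Summable (termP N w P w' (mono pw (fun t => t μ) r)) →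
      HasSum (termP N w P w' (mono pw (fun t => t μ) r)) 0 := by
    intro ρ ν μ pw r hL hR hSm
    have h := hasSum_termP_left w P w' hN hP pw hL (fun t => t μ) r (fun b => hm1 b μ) (ν := fun _ => ν) hR hSm
    rwa [← Finset.sum_mul, hT1 μ, zero_mul, mul_zero] at h
  rw [second_weight_expand, termP_add, termP_sub, termP_sub, termP_add, termP_sub, termP_sub, termP_add, termP_add]
  simp only [Pi.add_def, Pi.sub_def]
  have h := ((((((((hasSum_termP_left w P w' hN hP _ hW _ _ hm2 hW' (hS _ _ _ .one (.coord2 κ l) .one)).add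
    (hfirst κ _ _ hW (fun a => hR1 a l) (hS _ _ _ .one (.coord κ) (.coord l)))).add
    (hfirst l _ _ hW (fun a => hR1 a κ) (hS _ _ _ .one (.coord l) (.coord κ)))).sub
    (hfirst κ _ _ (fun a => hL1 a l) hW' (hS _ _ _ (.coord l) (.coord κ) .one))).sub
    (hfirst l _ _ (fun a => hL1 a κ) hW' (hS _ _ _ (.coord κ) (.coord l) .one))).add
    (hasSum_termP_left_of_zero w P w' _ hW _ (fun x => x κ * x l) h0' (hS _ _ _ .one .one (.coord2 κ l)))).sub
    (hasSum_termP_left_of_zero w P w' _ (fun a => hL1 a l) _ (fun x => x κ) h0'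
      (hS _ _ _ (.coord l) .one (.coord κ)))).sub
    (hasSum_termP_left_of_zero w P w' _ (fun a => hL1 a κ) _ (fun x => x l) h0'
      (hS _ _ _ (.coord κ) .one (.coord l)))).add
    (hasSum_termP_right_of_zero w P w' hP hR0 (fun u => u κ * u l) hrow (hS _ _ _ (.coord2 κ l) .one .one))
  simp only [add_zero, sub_zero] at h
  rwa [← Finset.sum_mul, show σ * ((∑ b : Fin d → Fin N, m₂ (resSite b)) * σ')
    = σ * σ' * ∑ b : Fin d → Fin N, m₂ (resSite b) by ring] at h

/-- CONSISTENCY: for a translation-invariant kernel the vanishing form gives back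
`DecimatedMomentSummable.decimatedSum_second_moment_hasSum`'s value `σ · m₂ · n₀` (`n₀ = N^d · σ'` by
`DressedMomentNormalisation.hasSum_total_of_constReproSum`, and `Σ_b m₂ = N^d · m₂`). [folklore] -/
theorem sum_const_mul_eq (hN : 0 < N) {w' : (Fin d → ℤ) → ℝ} {σ' : ℝ} (hR0 : ConstReproSum N w' σ') (σ m₂ : ℝ) :
    σ * σ' * ∑ _b : Fin d → Fin N, m₂ = σ * m₂ * ∑' x, w' x := by
  rw [(DressedMomentNormalisation.hasSum_total_of_constReproSum hN hR0).tsum_eq, Finset.sum_const, Finset.card_univ,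
    Fintype.card_pi, Finset.prod_const, Finset.card_univ, Fintype.card_fin, Fintype.card_fin, nsmul_eq_mul, Nat.cast_pow]
  ring

end Master

end Summit.QuantumFields.BalabanUV.Beta.D1BFx.MomentTransferPeriodicMaster
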